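import Summits.QuantumFields.GaugeBoot.ERowAlgebra
import HarnessLib

/-!
# Row canonical forms for kernel-checked bindings (LEQ-SCALING R2⁺⁺)

Cell `pub-gaugeboot` (HOME `run/shared/lean/pub/pub-gaugeboot/`), seat lean2 — companion of `ERowAlgebra.lean`.

HONEST FRAMING (page 1 of every file of this cell): certified bounds on lattice expectations at STATED coupling, gauge
group, dimension and torus size; NOT a mass gap, NOT a continuum limit, NOT a string tension, NOT large `N`; NOT
Yang–Mills-summit-bearing (barriers `FixedCouplingUltralocality`, `PerturbativeInvisibility`).

## Why

`ERowAlgebra.GRow.equiv` compares two rows order-free by recomputing total coefficients label by label — quadratic with a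
large constant, and in practice too slow for the kernel on the dense reduced rows of the certified problem files (a 120-term
problem row against a 600-term combination did not finish).  Here the comparison goes through a CANONICAL FORM instead:
`GRow.canon lt r` inserts the terms one by one into a label-sorted accumulator (any Boolean `lt`; equal labels are merged on the
way) and drops zero coefficients; `rowVal_canon : rowVal β v (canon lt r) = rowVal β v r` holds for EVERY `lt` (soundness does
not depend on `lt` being an order), so `canon lt r = canon lt s` (one `decide`, seconds on the dense rows) transfers values:
`rowVal_eq_of_canon_eq`, `rowVal_eq_zero_of_canon_eq_lincomb`.  `Word.ltw` is the generators' step-code order on words.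
Everything is `[folklore]`.
-/

noncomputable section

open Literature.MathematicalPhysics.QuantumFieldTheory

namespace Summit.QuantumFields.GaugeBoot

section Canon

variable {α : Type} [DecidableEq α] (lt : α → α → Bool)

/-- Insert a term into a row, merging with an equal label met before the insertion point chosen by `lt`. [folklore] -/
def GRow.insT (t : α × ℚ × ℚ) : GRow α → GRow α
  | [] => [t]
  | u :: r => if t.1 = u.1 then (u.1, u.2.1 + t.2.1, u.2.2 + t.2.2) :: r
      else if lt t.1 u.1 then t :: u :: r else u :: GRow.insT t r

/-- Canonical form: terms inserted one by one (sorted by `lt`, equal labels merged), zero coefficients dropped. [folklore] -/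
def GRow.canon (r : GRow α) : GRow α := (r.foldr (GRow.insT lt) []).filter fun t => t.2.1 ≠ 0 ∨ t.2.2 ≠ 0

variable (β : ℝ) (v : α → ℝ)

/-- Insertion adds the value of the term (wherever it lands). [folklore] -/
theorem rowVal_insT (t : α × ℚ × ℚ) (r : GRow α) : rowVal β v (GRow.insT lt t r) = rowVal β v r + rowVal β v [t] := by
  induction r with
  | nil => simp [GRow.insT]
  | cons u r ih =>
    simp only [GRow.insT]
    split_ifs with h1 h2
    · simp only [rowVal_cons, rowVal_nil, h1]; push_cast; ring
    · simp only [rowVal_cons, rowVal_nil]; ring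
    · simp only [rowVal_cons, ih, rowVal_nil]; ring

omit [DecidableEq α] in
/-- Dropping zero coefficients preserves the value. [folklore] -/
theorem rowVal_filter_ne_zero (r : GRow α) :
    rowVal β v (r.filter fun t => t.2.1 ≠ 0 ∨ t.2.2 ≠ 0) = rowVal β v r := by
  induction r with
  | nil => simp
  | cons t r ih =>
    simp only [List.filter_cons] at ih ⊢
    split_ifs with h
    · simp only [rowVal_cons, ih]
    · simp only [decide_eq_true_eq, not_or, not_not] at h
      simp only [rowVal_cons, ih, h.1, h.2]; push_cast; ring

/-- **The canonical form has the same value**, for every `lt`. [folklore] -/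
theorem rowVal_canon (r : GRow α) : rowVal β v (GRow.canon lt r) = rowVal β v r := by
  unfold GRow.canon
  rw [rowVal_filter_ne_zero]
  induction r with
  | nil => simp
  | cons t r ih => rw [List.foldr_cons, rowVal_insT, ih, rowVal_cons, rowVal_cons, rowVal_nil]; ring

/-- Rows with equal canonical forms have equal values. [folklore] -/
theorem rowVal_eq_of_canon_eq (r s : GRow α) (h : GRow.canon lt r = GRow.canon lt s) : rowVal β v r = rowVal β v s := by
  rw [← rowVal_canon lt β v r, h, rowVal_canon]

/-- **Transfer through canonical forms**: a row whose canonical form equals that of a linear combination of vanishing rows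
evaluated at the rational coupling `β₀` vanishes at `β₀` (`h` by ONE `decide`). [folklore] -/
theorem rowVal_eq_zero_of_canon_eq_lincomb (β₀ : ℚ) (r : GRow α) (cs : List (ℚ × GRow α))
    (h : GRow.canon lt r = GRow.canon lt (GRow.evalAt β₀ (GRow.lincomb cs))) (hcs : ∀ p ∈ cs, rowVal (β₀ : ℝ) v p.2 = 0) :
    rowVal (β₀ : ℝ) v r = 0 := by
  rw [rowVal_eq_of_canon_eq lt (β₀ : ℝ) v r _ h, rowVal_evalAt, rowVal_lincomb_eq_zero _ v cs hcs]

end Canon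

/-! ## The step-code order on words (eng1 G1: `+e_μ ↦ 2μ`, `−e_μ ↦ 2μ + 1`, lexicographic) -/

/-- G1's step code. [folklore] -/
def Step.code {d : ℕ} : Step d → ℕ
  | .fwd μ => 2 * μ.1
  | .bwd μ => 2 * μ.1 + 1

/-- Lexicographic comparison of words by step codes (a proper prefix is smaller). [folklore] -/
def Word.ltw {d : ℕ} : Word d → Word d → Bool
  | [], [] => false
  | [], _ :: _ => true
  | _ :: _, [] => false
  | a :: u, b :: w => if a.code < b.code then true else if b.code < a.code then false else Word.ltw u w

/-- Example (closed computation): `−(abAB) + 2·(abAB)` and `(abAB)` written differently have the same canonical form. [folklore] -/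
example : GRow.canon Word.ltw ([([.fwd 0, .fwd 1, .bwd 0, .bwd 1], -1, 0), ([], 0, 1), ([.fwd 0, .fwd 1, .bwd 0, .bwd 1], 2, 0)] : ERow) =
    GRow.canon Word.ltw [([], 0, 1), ([.fwd 0, .fwd 1, .bwd 0, .bwd 1], 1, 0)] := by
  decide +kernel

end Summit.QuantumFields.GaugeBoot

end
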